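import Summits.Ventures.CertifiedManyBodySolver.Downfold.EmeryFermiFillingHg1201Subs
import Summits.Ventures.CertifiedManyBodySolver.Downfold.EmeryFermiFillingLa214
import Summits.Ventures.CertifiedManyBodySolver.Downfold.EmeryBoxesHg1201TppP
import Summits.Ventures.CertifiedManyBodySolver.Downfold.EmeryBoxesPressure
import HarnessLib

/-!
# HgBa₂CuO₄: the 3BE boxes of record at P = 0 and P = 10 GPa ⇒ CERTIFIED windows for the object-E Fermi-surface `t′/t`
# of the σ three-band model at the boxes' own hole count — and a certified MODEL-FORM CEILING against the E row of record

Venture CertifiedManyBodySolver, cell `pub/hubbard-downfold` (stage S1, HUMAN RULINGS D-0096/D-0098), seat hubbard-downfold-mod-4 (technique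
B = band level); namespace `Summit.Ventures.CertifiedManyBodySolver.Downfold.Emery`. Everything here is PROVED; all numerics decided by the
kernel (`EmeryFermiFillingHg1201Subs`). Companion of `EmeryFermiFillingLa214` (same device, same grid table).

THE STATEMENTS. For every parameter vector of the typed Hg-1201 three-band box and every Fermi energy at which the σ-model antibonding
band holds the box's electrons — per-spin filling `abFilling(ε) = (2 − n_H)/2` with the box's own `n_H ∈ [1.125, 1.16]` (p ≈ 0.125–0.16), hence
`abFilling ∈ [0.42, 0.4375]` — the exact `t–t′` Fermi-surface shape of the σ model has
* P = 0 (`emeryBoxHg1201v114`, §OF-RECORD v1.14: Δ_pd [1.4, 2.5], t_pd [1.12, 1.32], t_pp [0.64, 0.85], |t_pp′| [0.111, 0.208]):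
  **`t′/t ∈ [-0.3717, -0.2486]`**, ε_F ∈ [1.06, 2.3] eV above ε_d (`emeryBoxHg1201v114_fsRatio_window`, and on the
  older `emeryBoxHg1201` by refinement);
* P = 10 GPa (`emeryBoxHg1201P10`: Δ_pd [1.15, 2.5], t_pd [1.39, 1.54], t_pp [0.68, 0.79], t_pp′ = 0.1156):
  **`t′/t ∈ [-0.3222, -0.2425]`**, ε_F ∈ [1.56, 2.8] (`emeryBoxHg1201P10_fsRatio_window`).

READING 1 — MODEL-FORM CEILING (certified, numbers not adjectives). Box #19's object-E row of record is `t′/t (E) ∈ [−0.57, −0.46]`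
(`router/BOXES/HgBa2CuO4.md` §DFT-1b v0.1 / ONE-BAND BOX: t–t′-only refit of the one-band Wannier band at E_F). The σ three-band model cannot reach
it ANYWHERE in its 3BE box: `t′/t ≥ -0.3717 > −0.46` at P = 0 (`emeryBoxHg1201v114_fsRatio_not_objectE`) and `≥ -0.3222` at 10 GPa. This is
the kernel form of the cell's MODEL-FORM note (router/INFLATION-RULES-3to1-B.md §B.5/§B.10, kit j260838: ≈ 2/3 of Hg-1201's one-band `t′` lives in the
axial Cu-4s / apical channel of [PavariniEtAl2001], absent from the σ model): for Hg-1201 the d–p_x–p_y(+t_pp, t_pp′) model is CERTIFIED INSUFFICIENT for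
the Fermi-surface shape of record, uniformly over the parameter box — INFL-3to1-B(t′/t of E, Hg-1201) ≥ 0.088 in |t′/t| at every box point, by theorem.
(For La₂CuO₄ the same device finds the σ window [−0.2955, −0.1653] OVERLAPPING the E row [−0.30, −0.20]: `EmeryFermiFillingLa214`.)

READING 2 — THE P AXIS. The two certified hulls: P = 0 [-0.3717, -0.2486] vs 10 GPa [-0.3222, -0.2425]: compression
removes the strongly-curved end (the 10-GPa box has larger t_pd and a pinned small t_pp′, both of which flatten the σ Fermi surface by
`fsRatio_mono_tpd` / `fsRatio_anti_c`), consistent in SIGN with box #19's P-axis row dln|t′/t|/dP < 0 for the σ channel; a hull-vs-hull comparison,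
not a pointwise derivative.

WHAT THIS IS NOT: not a statement that Hg-1201's parameters ARE in the boxes (SCREENING-GRADE provenance); the theorem certifies the REDUCTION
STEP of the σ model only; not the interaction (`U`) reduction; no phase sentence. Sources: [HybertsenSchluterChristensen1989, Eq. (1)];
[AndersenEtAl1995, §6]; [PavariniEtAl2001, Eq. (1)].
-/

noncomputable section

namespace Summit.Ventures.CertifiedManyBodySolver.Downfold.Emery

open Real Set
open Summit.Ventures.CertifiedManyBodySolver.Downfold

/-- Per-spin antibonding filling from the hole count: `n_H ∈ [9/8, 29/25] ⇒ (2 − n_H)/2 ∈ [21/50, 7/16]`. [folklore] -/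
theorem abFilling_row_of_nHoles {nH f : ℝ} (h1 : (9 / 8 : ℝ) ≤ nH) (h2 : nH ≤ (29 / 25 : ℝ)) (hf : f = (2 - nH) / 2) :
    f ∈ Set.Icc (21 / 50 : ℝ) (7 / 16) := by
  rw [hf]; constructor <;> linarith

/-- **Hg-1201 P = 0 (box #19 §OF-RECORD v1.14, `emeryBoxHg1201v114`): 3BE box ⇒ object-E `t′/t` window (raw coordinates)**: for Δ_pd ∈ [1.4, 2.5],
t_pd ∈ [1.12, 1.32], t_pp ∈ [0.64, 0.85], t_pp′ ∈ [0.111, 0.208] and every Fermi energy with per-spin filling in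
[0.42, 0.4375]: `ε ∈ [1.06, 2.3]` and `t′/t ∈ [-0.3717, -0.2486]`. [folklore] -/
theorem hg1201P0Box_fsRatio_window {Δ tpd tpp c ε : ℝ} (hΔ : Δ ∈ Set.Icc (7 / 5 : ℝ) (5 / 2 : ℝ))
    (ha : tpd ∈ Set.Icc (28 / 25 : ℝ) (33 / 25 : ℝ)) (hb : tpp ∈ Set.Icc (16 / 25 : ℝ) (17 / 20 : ℝ))
    (hc : c ∈ Set.Icc (111 / 1000 : ℝ) (26 / 125 : ℝ))
    (hν : abFilling Δ tpd tpp c ε ∈ Set.Icc (21 / 50 : ℝ) (7 / 16)) :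
    ε ∈ Set.Icc (53 / 50 : ℝ) (23 / 10 : ℝ) ∧ fsRatio Δ tpd tpp c ε ∈ Set.Icc (-(3717 / 10000 : ℝ)) (-(1243 / 5000 : ℝ)) := by
  have hΔ' := hΔ
  constructor
  · clear hΔ
    rcases mem_Icc_split hΔ' (39 / 20 : ℝ) with hΔ' | hΔ'
    · rcases mem_Icc_split hΔ' (67 / 40 : ℝ) with hΔ' | hΔ'
      · rcases mem_Icc_split ha (61 / 50 : ℝ) with ha' | ha'
        · have h := (hg1201P0Sub_0_0 hΔ' ha' hb hc hν).1
          exact ⟨le_trans (by norm_num) h.1, h.2.trans (by norm_num)⟩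
        · have h := (hg1201P0Sub_0_1 hΔ' ha' hb hc hν).1
          exact ⟨le_trans (by norm_num) h.1, h.2.trans (by norm_num)⟩
      · rcases mem_Icc_split ha (61 / 50 : ℝ) with ha' | ha'
        · have h := (hg1201P0Sub_1_0 hΔ' ha' hb hc hν).1
          exact ⟨le_trans (by norm_num) h.1, h.2.trans (by norm_num)⟩
        · have h := (hg1201P0Sub_1_1 hΔ' ha' hb hc hν).1
          exact ⟨le_trans (by norm_num) h.1, h.2.trans (by norm_num)⟩
    · rcases mem_Icc_split hΔ' (89 / 40 : ℝ) with hΔ' | hΔ'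
      · rcases mem_Icc_split ha (61 / 50 : ℝ) with ha' | ha'
        · have h := (hg1201P0Sub_2_0 hΔ' ha' hb hc hν).1
          exact ⟨le_trans (by norm_num) h.1, h.2.trans (by norm_num)⟩
        · have h := (hg1201P0Sub_2_1 hΔ' ha' hb hc hν).1
          exact ⟨le_trans (by norm_num) h.1, h.2.trans (by norm_num)⟩
      · rcases mem_Icc_split ha (61 / 50 : ℝ) with ha' | ha'
        · have h := (hg1201P0Sub_3_0 hΔ' ha' hb hc hν).1
          exact ⟨le_trans (by norm_num) h.1, h.2.trans (by norm_num)⟩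
        · have h := (hg1201P0Sub_3_1 hΔ' ha' hb hc hν).1
          exact ⟨le_trans (by norm_num) h.1, h.2.trans (by norm_num)⟩
  · clear hΔ
    rcases mem_Icc_split hΔ' (39 / 20 : ℝ) with hΔ' | hΔ'
    · rcases mem_Icc_split hΔ' (67 / 40 : ℝ) with hΔ' | hΔ'
      · rcases mem_Icc_split ha (61 / 50 : ℝ) with ha' | ha'
        · have h := (hg1201P0Sub_0_0 hΔ' ha' hb hc hν).2
          exact ⟨le_trans (by norm_num) h.1, h.2.trans (by norm_num)⟩
        · have h := (hg1201P0Sub_0_1 hΔ' ha' hb hc hν).2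
          exact ⟨le_trans (by norm_num) h.1, h.2.trans (by norm_num)⟩
      · rcases mem_Icc_split ha (61 / 50 : ℝ) with ha' | ha'
        · have h := (hg1201P0Sub_1_0 hΔ' ha' hb hc hν).2
          exact ⟨le_trans (by norm_num) h.1, h.2.trans (by norm_num)⟩
        · have h := (hg1201P0Sub_1_1 hΔ' ha' hb hc hν).2
          exact ⟨le_trans (by norm_num) h.1, h.2.trans (by norm_num)⟩
    · rcases mem_Icc_split hΔ' (89 / 40 : ℝ) with hΔ' | hΔ'
      · rcases mem_Icc_split ha (61 / 50 : ℝ) with ha' | ha'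
        · have h := (hg1201P0Sub_2_0 hΔ' ha' hb hc hν).2
          exact ⟨le_trans (by norm_num) h.1, h.2.trans (by norm_num)⟩
        · have h := (hg1201P0Sub_2_1 hΔ' ha' hb hc hν).2
          exact ⟨le_trans (by norm_num) h.1, h.2.trans (by norm_num)⟩
      · rcases mem_Icc_split ha (61 / 50 : ℝ) with ha' | ha'
        · have h := (hg1201P0Sub_3_0 hΔ' ha' hb hc hν).2
          exact ⟨le_trans (by norm_num) h.1, h.2.trans (by norm_num)⟩
        · have h := (hg1201P0Sub_3_1 hΔ' ha' hb hc hν).2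
          exact ⟨le_trans (by norm_num) h.1, h.2.trans (by norm_num)⟩

/-- **Hg-1201 P = 10 GPa (box #19 §P-INTERVALS column, `emeryBoxHg1201P10`): 3BE box ⇒ object-E `t′/t` window (raw coordinates)**: for Δ_pd ∈ [1.15, 2.5],
t_pd ∈ [1.39, 1.54], t_pp ∈ [0.68, 0.79], t_pp′ ∈ [0.1156, 0.1156] and every Fermi energy with per-spin filling in
[0.42, 0.4375]: `ε ∈ [1.56, 2.8]` and `t′/t ∈ [-0.3222, -0.2425]`. [folklore] -/
theorem hg1201P10Box_fsRatio_window {Δ tpd tpp c ε : ℝ} (hΔ : Δ ∈ Set.Icc (23 / 20 : ℝ) (5 / 2 : ℝ))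
    (ha : tpd ∈ Set.Icc (139 / 100 : ℝ) (77 / 50 : ℝ)) (hb : tpp ∈ Set.Icc (17 / 25 : ℝ) (79 / 100 : ℝ))
    (hc : c ∈ Set.Icc (289 / 2500 : ℝ) (289 / 2500 : ℝ))
    (hν : abFilling Δ tpd tpp c ε ∈ Set.Icc (21 / 50 : ℝ) (7 / 16)) :
    ε ∈ Set.Icc (39 / 25 : ℝ) (14 / 5 : ℝ) ∧ fsRatio Δ tpd tpp c ε ∈ Set.Icc (-(1611 / 5000 : ℝ)) (-(97 / 400 : ℝ)) := by
  have hΔ' := hΔ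
  constructor
  · clear hΔ
    rcases mem_Icc_split hΔ' (73 / 40 : ℝ) with hΔ' | hΔ'
    · rcases mem_Icc_split hΔ' (119 / 80 : ℝ) with hΔ' | hΔ'
      · rcases mem_Icc_split ha (293 / 200 : ℝ) with ha' | ha'
        · have h := (hg1201P10Sub_0_0 hΔ' ha' hb hc hν).1
          exact ⟨le_trans (by norm_num) h.1, h.2.trans (by norm_num)⟩
        · have h := (hg1201P10Sub_0_1 hΔ' ha' hb hc hν).1
          exact ⟨le_trans (by norm_num) h.1, h.2.trans (by norm_num)⟩
      · rcases mem_Icc_split ha (293 / 200 : ℝ) with ha' | ha'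
        · have h := (hg1201P10Sub_1_0 hΔ' ha' hb hc hν).1
          exact ⟨le_trans (by norm_num) h.1, h.2.trans (by norm_num)⟩
        · have h := (hg1201P10Sub_1_1 hΔ' ha' hb hc hν).1
          exact ⟨le_trans (by norm_num) h.1, h.2.trans (by norm_num)⟩
    · rcases mem_Icc_split hΔ' (173 / 80 : ℝ) with hΔ' | hΔ'
      · rcases mem_Icc_split ha (293 / 200 : ℝ) with ha' | ha'
        · have h := (hg1201P10Sub_2_0 hΔ' ha' hb hc hν).1
          exact ⟨le_trans (by norm_num) h.1, h.2.trans (by norm_num)⟩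
        · have h := (hg1201P10Sub_2_1 hΔ' ha' hb hc hν).1
          exact ⟨le_trans (by norm_num) h.1, h.2.trans (by norm_num)⟩
      · rcases mem_Icc_split ha (293 / 200 : ℝ) with ha' | ha'
        · have h := (hg1201P10Sub_3_0 hΔ' ha' hb hc hν).1
          exact ⟨le_trans (by norm_num) h.1, h.2.trans (by norm_num)⟩
        · have h := (hg1201P10Sub_3_1 hΔ' ha' hb hc hν).1
          exact ⟨le_trans (by norm_num) h.1, h.2.trans (by norm_num)⟩
  · clear hΔ
    rcases mem_Icc_split hΔ' (73 / 40 : ℝ) with hΔ' | hΔ'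
    · rcases mem_Icc_split hΔ' (119 / 80 : ℝ) with hΔ' | hΔ'
      · rcases mem_Icc_split ha (293 / 200 : ℝ) with ha' | ha'
        · have h := (hg1201P10Sub_0_0 hΔ' ha' hb hc hν).2
          exact ⟨le_trans (by norm_num) h.1, h.2.trans (by norm_num)⟩
        · have h := (hg1201P10Sub_0_1 hΔ' ha' hb hc hν).2
          exact ⟨le_trans (by norm_num) h.1, h.2.trans (by norm_num)⟩
      · rcases mem_Icc_split ha (293 / 200 : ℝ) with ha' | ha'
        · have h := (hg1201P10Sub_1_0 hΔ' ha' hb hc hν).2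
          exact ⟨le_trans (by norm_num) h.1, h.2.trans (by norm_num)⟩
        · have h := (hg1201P10Sub_1_1 hΔ' ha' hb hc hν).2
          exact ⟨le_trans (by norm_num) h.1, h.2.trans (by norm_num)⟩
    · rcases mem_Icc_split hΔ' (173 / 80 : ℝ) with hΔ' | hΔ'
      · rcases mem_Icc_split ha (293 / 200 : ℝ) with ha' | ha'
        · have h := (hg1201P10Sub_2_0 hΔ' ha' hb hc hν).2
          exact ⟨le_trans (by norm_num) h.1, h.2.trans (by norm_num)⟩
        · have h := (hg1201P10Sub_2_1 hΔ' ha' hb hc hν).2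
          exact ⟨le_trans (by norm_num) h.1, h.2.trans (by norm_num)⟩
      · rcases mem_Icc_split ha (293 / 200 : ℝ) with ha' | ha'
        · have h := (hg1201P10Sub_3_0 hΔ' ha' hb hc hν).2
          exact ⟨le_trans (by norm_num) h.1, h.2.trans (by norm_num)⟩
        · have h := (hg1201P10Sub_3_1 hΔ' ha' hb hc hν).2
          exact ⟨le_trans (by norm_num) h.1, h.2.trans (by norm_num)⟩

/-- The five one-body/filling rows of the typed P = 0 companion of record `emeryBoxHg1201v114` (`EmeryBoxesHg1201TppP`:
`emeryBoxHg1201` with `tppP` re-pointed to [0.111, 0.208]). [folklore] -/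
theorem emeryBoxHg1201v114_mem_rows {p : EmeryCoord → ℝ} (hp : emeryBoxHg1201v114.Mem p) :
    p .DeltaPd ∈ Set.Icc (7 / 5 : ℝ) (5 / 2) ∧ p .tpd ∈ Set.Icc (28 / 25 : ℝ) (33 / 25) ∧
      p .tpp ∈ Set.Icc (16 / 25 : ℝ) (17 / 20) ∧ p .tppP ∈ Set.Icc (111 / 1000 : ℝ) (26 / 125) ∧
      p .nHoles ∈ Set.Icc (9 / 8 : ℝ) (29 / 25) := by
  have hΔ := (Entry.mem_ofEnds_iff _ _ _ _ _).1
    (hp .DeltaPd hg1201Emery_Delta (by rw [emeryBoxHg1201v114_of_ne (by decide)]; rfl))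
  have ha := (Entry.mem_ofEnds_iff _ _ _ _ _).1
    (hp .tpd hg1201Emery_tpd (by rw [emeryBoxHg1201v114_of_ne (by decide)]; rfl))
  have hb := (Entry.mem_ofEnds_iff _ _ _ _ _).1
    (hp .tpp hg1201Emery_tpp (by rw [emeryBoxHg1201v114_of_ne (by decide)]; rfl))
  have hc := (Entry.mem_ofEnds_iff _ _ _ _ _).1 (hp .tppP hg1201Emery_tppP_v114 emeryBoxHg1201v114_tppP)
  have hn := (Entry.mem_ofEnds_iff _ _ _ _ _).1
    (hp .nHoles hg1201Emery_nH (by rw [emeryBoxHg1201v114_of_ne (by decide)]; rfl))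
  push_cast at hΔ ha hb hc hn
  exact ⟨⟨hΔ.1, hΔ.2⟩, ⟨ha.1, ha.2⟩, ⟨hb.1, hb.2⟩, ⟨hc.1, hc.2⟩, ⟨hn.1, hn.2⟩⟩

/-- **THE WORD ON THE TYPED P = 0 BOX OF RECORD `emeryBoxHg1201v114`** (box #19 §OF-RECORD v1.14): at every parameter vector and every
Fermi energy at which the σ-model antibonding band holds the box's own electron count (`abFilling = (2 − n_H)/2`, `n_H ∈ [1.125, 1.16]`), the
Fermi energy lies in `[1.06, 2.3]` (eV above ε_d) and the exact σ-model Fermi-surface `t′/t` lies in `[−0.3717, −0.2486]`.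
[cite: HybertsenSchluterChristensen1989, Eq. (1) (three-band d–p model)] -/
theorem emeryBoxHg1201v114_fsRatio_window :
    HoldsOn (fun p : EmeryCoord → ℝ => ∀ ε : ℝ,
      abFilling (p .DeltaPd) (p .tpd) (p .tpp) (p .tppP) ε = (2 - p .nHoles) / 2 →
      ε ∈ Set.Icc (53 / 50 : ℝ) (23 / 10 : ℝ) ∧
      fsRatio (p .DeltaPd) (p .tpd) (p .tpp) (p .tppP) ε ∈ Set.Icc (-(3717 / 10000 : ℝ)) (-(1243 / 5000 : ℝ))) emeryBoxHg1201v114 := by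
  intro p hp ε hf
  obtain ⟨hΔ, ha, hb, hc, hn⟩ := emeryBoxHg1201v114_mem_rows hp
  exact hg1201P0Box_fsRatio_window hΔ ha hb hc (abFilling_row_of_nHoles hn.1 hn.2 hf)

/-- The same word on the older typed companion `emeryBoxHg1201` (`EmeryBoxesCuprates`, `tppP` [0.161, 0.208] ⊆ the v1.14 row). [folklore] -/
theorem emeryBoxHg1201_fsRatio_window :
    HoldsOn (fun p : EmeryCoord → ℝ => ∀ ε : ℝ,
      abFilling (p .DeltaPd) (p .tpd) (p .tpp) (p .tppP) ε = (2 - p .nHoles) / 2 →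
      ε ∈ Set.Icc (53 / 50 : ℝ) (23 / 10 : ℝ) ∧
      fsRatio (p .DeltaPd) (p .tpd) (p .tpp) (p .tppP) ε ∈ Set.Icc (-(3717 / 10000 : ℝ)) (-(1243 / 5000 : ℝ))) emeryBoxHg1201 :=
  fun p hp => emeryBoxHg1201v114_fsRatio_window p (emeryBoxHg1201_refines_v114 p hp)

/-- **MODEL-FORM CEILING, CERTIFIED**: on the whole P = 0 box the σ-model Fermi-surface `t′/t` stays above `−0.3717 > −0.46`, hence OUTSIDE
box #19's object-E row of record `[−0.57, −0.46]` — the d–p_x–p_y(+t_pp, t_pp′) model cannot produce Hg-1201's one-band Fermi-surface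
shape anywhere in its 3BE box (the axial channel carries the rest). [cite: PavariniEtAl2001, Eq. (1) and Fig. 2 (t, t′, t″ one-band form)] -/
theorem emeryBoxHg1201v114_fsRatio_not_objectE :
    HoldsOn (fun p : EmeryCoord → ℝ => ∀ ε : ℝ,
      abFilling (p .DeltaPd) (p .tpd) (p .tpp) (p .tppP) ε = (2 - p .nHoles) / 2 →
      fsRatio (p .DeltaPd) (p .tpd) (p .tpp) (p .tppP) ε ∉ Set.Icc (-(57 / 100 : ℝ)) (-(23 / 50 : ℝ))) emeryBoxHg1201v114 := by
  intro p hp ε hf hmem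
  have h := (emeryBoxHg1201v114_fsRatio_window p hp ε hf).2
  have : (-(23 / 50 : ℝ)) < (-(3717 / 10000 : ℝ)) := by norm_num
  linarith [h.1, hmem.2]

/-- **THE WORD ON THE TYPED P = 10 GPa BOX `emeryBoxHg1201P10`** (`EmeryBoxesPressure`; box #19 §P-INTERVALS): at the box's own electron
count the Fermi energy lies in `[1.56, 2.8]` and the σ-model Fermi-surface `t′/t` in `[−0.3222, −0.2425]`.
[cite: HybertsenSchluterChristensen1989, Eq. (1) (three-band d–p model)] -/
theorem emeryBoxHg1201P10_fsRatio_window :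
    HoldsOn (fun p : EmeryCoord → ℝ => ∀ ε : ℝ,
      abFilling (p .DeltaPd) (p .tpd) (p .tpp) (p .tppP) ε = (2 - p .nHoles) / 2 →
      ε ∈ Set.Icc (39 / 25 : ℝ) (14 / 5 : ℝ) ∧
      fsRatio (p .DeltaPd) (p .tpd) (p .tpp) (p .tppP) ε ∈ Set.Icc (-(1611 / 5000 : ℝ)) (-(97 / 400 : ℝ))) emeryBoxHg1201P10 := by
  intro p hp ε hf
  obtain ⟨h1, h2, h3, h4, h5, h6, h7, h8, -, -, -, -, -, -, hn1, hn2⟩ := (emeryBoxHg1201P10_mem_iff p).1 hp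
  push_cast at h1 h2 h3 h4 h5 h6 h7 h8 hn1 hn2
  exact hg1201P10Box_fsRatio_window ⟨h1, h2⟩ ⟨h3, h4⟩ ⟨h5, h6⟩ ⟨h7, h8⟩ (abFilling_row_of_nHoles hn1 hn2 hf)

/-- **MODEL-FORM CEILING AT 10 GPa**: the σ-model `t′/t` stays above `−0.3222 > −0.46` on the whole P = 10 GPa box. [folklore] -/
theorem emeryBoxHg1201P10_fsRatio_not_objectE :
    HoldsOn (fun p : EmeryCoord → ℝ => ∀ ε : ℝ,
      abFilling (p .DeltaPd) (p .tpd) (p .tpp) (p .tppP) ε = (2 - p .nHoles) / 2 →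
      fsRatio (p .DeltaPd) (p .tpd) (p .tpp) (p .tppP) ε ∉ Set.Icc (-(57 / 100 : ℝ)) (-(23 / 50 : ℝ))) emeryBoxHg1201P10 := by
  intro p hp ε hf hmem
  have h := (emeryBoxHg1201P10_fsRatio_window p hp ε hf).2
  have : (-(23 / 50 : ℝ)) < (-(1611 / 5000 : ℝ)) := by norm_num
  linarith [h.1, hmem.2]

end Summit.Ventures.CertifiedManyBodySolver.Downfold.Emery
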